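import Literature.Probability.LatticeModels.RandomClusterEdgeWeights
import Summits.CriticalPhenomena.PercolationContinuityZ3.Theorems.PercNearOneGluingNoHeavyLowerTailCSHDefs
import Summits.CriticalPhenomena.PercolationContinuityZ3.Theses.PercNearOneGluingNoHeavy
import Summits.CriticalPhenomena.PercolationContinuityZ3.Theses.PercNearOneGluing
import HarnessLib

/-!
# FK(`q`) analogues of the finite-graph statements of the CSH ⇒ AdditiveGluing chain — DEFINITIONS (parametrised by `q`)

Definitions file (`--supports stmt-CriticalPhenomena-4575`), FK sub-lane `prim-bschramm-fk-1` of the post-continuity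
programme; builds on p205010 (kernel theorem, internal audit signed; external expert review pending).  No named facts,
no sorries; standard axioms.  NOTHING here is claimed for `q ≠ 1`: these are the STATEMENTS that the sub-lane's
census (fk-3, "must fail for large `q`") and chain walk (fk-2, `q = 2`) test, link by link.

The chain proved in the tree for Bernoulli bond percolation on finite weighted graphs (`prodBernoulli w`,
`w : Sym2 (Fin n) → [0,1]`) — CSH ⇒ (S5) ⇒ (GEN) ⇒ (AG-loc) ⇒ `AdditiveGluing` ⇒ Kozma–Nitzan Conj. 3 (`NearOneGluing`),
and `NoHeavyLowerTail` — is transplanted to the random-cluster measure with edge parameters `w` and cluster weight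
`q`, `φ_{w,q} = rcMeasureW w q ∅` (Grimmett 2006, eq. (1.20); `Literature/Probability/LatticeModels/RandomClusterEdgeWeights.lean`;
free boundary condition — a wired set is emulated by weight-`1` edges, which are almost surely open), by the literal
substitution `prodBernoulli w ↦ rcMeasureW w q ∅` in each statement:

* `FK.AdditiveGluingFK q`, `FK.NearOneGluingFK q`, `FK.NoHeavyLowerTailFK q` — the route decls
  `PercNearOneGluing.AdditiveGluing`, `PercNearOneGluingNoHeavy.NearOneGluing`, `PercNearOneGluingNoHeavy.NoHeavyLowerTail`
  with `φ_{w,q}`;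
* `FK.AdditiveGluingUnder μ A o b` (measure as a parameter) and three CLOSED conjecture-shaped statements tagged `@[conjecture]`
  (obligation nodes, provable/refutable by name, NOT asserted): `FK.AdditiveGluingFKTwo` (`q = 2`), `FK.AdditiveGluingFKMonotone`
  (all `q ≥ 1`), `FK.AdditiveGluingFKGLattice` (every probability measure with the FKG lattice condition), logically
  `AdditiveGluingFKGLattice ⇒ AdditiveGluingFKMonotone ⇒ AdditiveGluingFKTwo` (`additiveGluingFK_of_fkgLattice`; no theorem with a conjecture as
  conclusion is stated, so that nothing is credited conditionally);
* `FK.ClusterCPAFK q` — the one-cluster conditional positive association of van den Berg–Häggström–Kahn (Thm. 1.3, the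
  printed input of Lemma T / (GEN)) for `φ_{w,q}`;
* `FK.CSHHoldsFor μ x Y D o v` — the conditioned slack hierarchy statement `CSH.CSHHolds` with the measure as a PARAMETER
  (`CSH.avoidConst/decoyList/obsConst/covD/cshMargin` verbatim with `μ` for `prodBernoulli w`), and `FK.CSHFK q` — memo
  Theorem 1 (`CSH.cshAll`'s statement) for `φ_{w,q}`.

Sanity (all proved here): at `q = 1` each analogue IS the Bernoulli statement (`rcMeasureW_one : rcMeasureW w 1 B = prodBernoulli w`):
`additiveGluingFK_one_iff`, `nearOneGluingFK_one_iff`, `noHeavyLowerTailFK_one_iff`, `cshHoldsFor_prodBernoulli_iff`,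
`cshFK_one_iff`, `clusterCPAFK_one` (from the tree's proof of vdBHK Thm. 1.3); and the measure-agnostic implication
`FK.nearOneGluingFK_of_additiveGluingFK` (`δ = ε/2`, as `additiveGluingSuffices_proof`).  What is known to constrain
`q > 1`: for `q ≥ 1` FKG holds (`rcMeasureW_fkg`), so every FKG-only link transplants; the 3D transition is first
order for large `q` (tree barrier `Literature.Barriers.CriticalPhenomena.RandomClusterFirstOrder_holds`, Grimmett 2006
Thm. (7.33)), so the infinite-volume conclusion must fail there and some finite link with it or the infinite-volume
seam — locating it is fk-3's task, not asserted here.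
[cite: Grimmett2006, §1.4 eq. (1.20) (p. 15); Thm. (3.8); Thm. (7.33)] [cite: KozmaNitzan2024, Conj. 1 (p. 3), Conj. 3 (p. 15)]
[cite: VandenbergHaggstromKahn2005, Thm. 1.3 (p. 6)]
-/

noncomputable section

namespace Summit.CriticalPhenomena.PercolationContinuityZ3.Theorems

open MeasureTheory Set Literature.Probability.LatticeModels Literature.Probability.Percolation
open scoped Classical
open Summit.CriticalPhenomena.PercolationContinuityZ3.Theses

namespace FK

/-! ### The gluing statements for `φ_{w,q}` -/

/-- **FK(`q`) additive gluing** — the route crux `PercNearOneGluing.AdditiveGluing` (`P(o ↔ b) ≥ P(o ↔ A) − t` for every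
slack `t ≥ max_{a∈A} P(a ↮ b)`, on every finite weighted graph) with the random-cluster measure `φ_{w,q} = rcMeasureW w q ∅`
in place of `prodBernoulli w`.  A statement parametrised by `q`; proved in the tree for `q = 1` only
(`additiveGluingFK_one_iff` + `CSH.additiveGluing_holds`); builds on p205010 (kernel theorem, internal audit signed;
external expert review pending). [cite: KozmaNitzan2024, Conj. 1 (p. 3)] [cite: Grimmett2006, §1.4 eq. (1.20) (p. 15)] -/
def AdditiveGluingFK (q : ℝ) : Prop :=
  ∀ (n : ℕ) (w : Sym2 (Fin n) → unitInterval) (A : Finset (Fin n)) (o b : Fin n) (t : ℝ), 0 ≤ t →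
    (∀ a ∈ A, 1 - t ≤ (rcMeasureW w q ∅).real (openConn a b)) →
      (rcMeasureW w q ∅).real (⋃ a ∈ A, openConn o a) - t ≤ (rcMeasureW w q ∅).real (openConn o b)

/-- **FK(`q`) near-one gluing** — Kozma–Nitzan's Conjecture 3 (route decl `PercNearOneGluingNoHeavy.NearOneGluing`) with
`φ_{w,q}` in place of `prodBernoulli w`: `∀ ε ∃ δ`, `φ(o ↔ A) > 1 − δ` and `φ(a ↔ b) > 1 − δ ∀ a ∈ A` imply `φ(o ↔ b) > 1 − ε`,
uniformly in `|A|`.  Parametrised by `q`; `q = 1` is the tree theorem `CSH.kozmaNitzan_conjecture3_holds` (builds on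
p205010 (kernel theorem, internal audit signed; external expert review pending)). [cite: KozmaNitzan2024, Conj. 3 (p. 15)] -/
def NearOneGluingFK (q : ℝ) : Prop :=
  ∀ ε : ℝ, 0 < ε → ∃ δ : ℝ, 0 < δ ∧ ∀ (n : ℕ) (w : Sym2 (Fin n) → unitInterval) (A : Finset (Fin n)) (o b : Fin n),
    1 - δ < (rcMeasureW w q ∅).real (⋃ a ∈ A, openConn o a) →
      (∀ a ∈ A, 1 - δ < (rcMeasureW w q ∅).real (openConn a b)) →
        1 - ε < (rcMeasureW w q ∅).real (openConn o b)

/-- **FK(`q`) no heavy lower tail** — the route crux `PercNearOneGluingNoHeavy.NoHeavyLowerTail` (the number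
`N = |C(o) ∩ A|` of relays met by the observer is not much smaller than its mean on `{N ≥ 1}`, for a `(1−δ)`-reliable
relay set) with `φ_{w,q}` in place of `prodBernoulli w`.  Parametrised by `q`; `q = 1` is `CSH.noHeavyLowerTail_holds`
(builds on p205010 (kernel theorem, internal audit signed; external expert review pending)). [cite: KozmaNitzan2024, Conj. 1 (p. 3)] -/
def NoHeavyLowerTailFK (q : ℝ) : Prop :=
  ∀ ε : ℝ, 0 < ε → ∃ δ : ℝ, 0 < δ ∧ ∀ (n : ℕ) (w : Sym2 (Fin n) → unitInterval) (A : Finset (Fin n)) (o : Fin n),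
    1 - δ < (rcMeasureW w q ∅).real (⋃ a ∈ A, openConn o a) →
      (∀ a ∈ A, ∀ a' ∈ A, 1 - δ < (rcMeasureW w q ∅).real (openConn a a')) →
        (rcMeasureW w q ∅).real {ω | 1 ≤ (A.filter fun a => ω ∈ openConn o a).card ∧
          ((A.filter fun a => ω ∈ openConn o a).card : ℝ) <
            δ * (∑ a ∈ A, (rcMeasureW w q ∅).real (openConn o a)) / ε} < ε

/-- **FK(`q`) one-cluster conditional positive association** — van den Berg–Häggström–Kahn's Theorem 1.3 (the tree's named
fact `BHK2006_clusterConditionalPositiveAssociation`, proved for product measures; the printed input of Lemma T and of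
(S5) ⇒ (GEN)) with `φ_{w,q}` in place of `prodBernoulli w`, on the vertex types `Fin n`: given `{s ↮ X}`, increasing
functions of the open edge cluster of `s` are positively correlated.  Parametrised by `q`; `q = 1` is `clusterCPAFK_one`.
[cite: VandenbergHaggstromKahn2005, Thm. 1.3 (p. 6)] [cite: Grimmett2006, §1.4 eq. (1.20) (p. 15)] -/
def ClusterCPAFK (q : ℝ) : Prop :=
  ∀ (n : ℕ) (w : Sym2 (Fin n) → unitInterval) (s : Fin n) (X : Set (Fin n)) (F G : Set (Sym2 (Fin n)) → ℝ),
    Monotone F → Monotone G → s ∉ X →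
    (∫ ω in {ω : BondConfig (Fin n) | ∀ x ∈ X, ¬ (openGraph ω).Reachable s x},
        F (openEdgeCluster ω s) ∂(rcMeasureW w q ∅)) *
      (∫ ω in {ω : BondConfig (Fin n) | ∀ x ∈ X, ¬ (openGraph ω).Reachable s x},
        G (openEdgeCluster ω s) ∂(rcMeasureW w q ∅)) ≤
    (rcMeasureW w q ∅).real {ω : BondConfig (Fin n) | ∀ x ∈ X, ¬ (openGraph ω).Reachable s x} *
      ∫ ω in {ω : BondConfig (Fin n) | ∀ x ∈ X, ¬ (openGraph ω).Reachable s x},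
        F (openEdgeCluster ω s) * G (openEdgeCluster ω s) ∂(rcMeasureW w q ∅)

/-! ### Additive gluing under an arbitrary measure; the FKG-lattice-condition form -/

/-- **Additive gluing under a given measure `μ`** on the bond configurations of a finite vertex type: for the relay set `A` and
observers `o, b`, `μ(o ↔ b) ≥ μ(o ↔ A) − t` for every slack `t ≥ max_{a∈A} μ(a ↮ b)` (the route crux `AdditiveGluing` is this for
`μ = prodBernoulli w`, all `n, w, A, o, b`; `AdditiveGluingFK q` for `μ = φ_{w,q}`).  Statement only (measure as a parameter), so that
"for which measures does additive gluing hold?" can be asked precisely. [cite: KozmaNitzan2024, Conj. 1 (p. 3)] -/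
def AdditiveGluingUnder {V : Type*} (μ : Measure (BondConfig V)) (A : Finset V) (o b : V) : Prop :=
  ∀ t : ℝ, 0 ≤ t → (∀ a ∈ A, 1 - t ≤ μ.real (openConn a b)) →
    μ.real (⋃ a ∈ A, openConn o a) - t ≤ μ.real (openConn o b)

/-- `AdditiveGluingFK q` is additive gluing under every `φ_{w,q}`. [folklore] -/
theorem additiveGluingFK_iff_under (q : ℝ) :
    AdditiveGluingFK q ↔ ∀ (n : ℕ) (w : Sym2 (Fin n) → unitInterval) (A : Finset (Fin n)) (o b : Fin n),
      AdditiveGluingUnder (rcMeasureW w q ∅) A o b :=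
  Iff.rfl

/-- **Additive gluing for every probability measure satisfying the FKG lattice condition** on `{0,1}^{Sym2 (Fin n)}`
(`μ{a} μ{b} ≤ μ{a ∩ b} μ{a ∪ b}`, Grimmett 2006 Thm. (2.19)/(2.24): the strongly positively-associated = monotonic measures; they
include `prodBernoulli w` and every `φ_{w,q}`, `q ≥ 1`, by `rcWeightW_lattice_condition`).  A CONJECTURE-SHAPED STATEMENT, recorded
because a clean FK(q) census of the finite links for large `q` would suggest exactly this (coordinator calibration 2026-08-20T05:23Z:
"the finite inequalities may be truths about all FKG/monotone measures — state that conjecture precisely"); NOT asserted.  At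
`μ = prodBernoulli w` it is the tree theorem `CSH.additiveGluing_holds` (builds on p205010 (kernel theorem, internal audit signed;
external expert review pending)). [cite: Grimmett2006, Thm. (2.19) and Thm. (2.24) (FKG lattice condition, monotonic measures)]
[cite: KozmaNitzan2024, Conj. 1 (p. 3)] -/
@[conjecture] def AdditiveGluingFKGLattice : Prop :=
  ∀ (n : ℕ) (μ : Measure (BondConfig (Fin n))), IsProbabilityMeasure μ →
    (∀ a b : BondConfig (Fin n), μ.real {a} * μ.real {b} ≤ μ.real {a ∩ b} * μ.real {a ∪ b}) →
      ∀ (A : Finset (Fin n)) (o b : Fin n), AdditiveGluingUnder μ A o b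

/-- **Additive gluing for every random-cluster measure with `q ≥ 1`** (all finite weighted graphs, free boundary condition; the
monotone = FKG range of `q`).  CONJECTURE-SHAPED STATEMENT of the FK sub-lane (FK-PLAN.md §4.2 S2), NOT asserted: `q = 1` is the tree
theorem `CSH.additiveGluing_holds` (builds on p205010 (kernel theorem, internal audit signed; external expert review pending)); every
`q > 1` is open and is what the lane's exact census tests first; implied by `AdditiveGluingFKGLattice`
(apply `additiveGluingFK_of_fkgLattice` at each `q ≥ 1`).  A refutation `¬ AdditiveGluingFKMonotone` by an explicit `(q, n, w, A, o, b)` is a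
legitimate and informative outcome. [cite: KozmaNitzan2024, Conj. 1 (p. 3)] [cite: Grimmett2006, §1.4 eq. (1.20) (p. 15); Thm. (3.8)] -/
@[conjecture] def AdditiveGluingFKMonotone : Prop := ∀ q : ℝ, 1 ≤ q → AdditiveGluingFK q

/-- **Additive gluing for the FK–Ising measures `φ_{w,2}`** (the `q = 2` route of the sub-lane, FK-PLAN.md §2: via Edwards–Sokal the
connection probabilities of `φ_{w,2}` are Ising correlations, `edwardsSokal_twoPoint_holds`).  CONJECTURE-SHAPED STATEMENT, NOT
asserted; the case `q = 2` of `AdditiveGluingFKMonotone`. [cite: KozmaNitzan2024, Conj. 1 (p. 3)]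
[cite: Grimmett2006, §1.4 eq. (1.20) (p. 15), Thm. (1.16)] -/
@[conjecture] def AdditiveGluingFKTwo : Prop := AdditiveGluingFK 2

/-- The point masses of `φ^B_{w,q}`: `φ{a} = w(a)/Z`. [cite: Grimmett2006, §1.4 eq. (1.20) (p. 15)] -/
theorem rcMeasureW_real_singleton {V : Type*} [Fintype V] (w : Sym2 V → unitInterval) {q : ℝ} (hq : 0 < q) (B : Set V)
    (a : BondConfig V) : (rcMeasureW w q B).real {a} = rcWeightW w q B a / rcPartitionFunctionW w q B := by
  rw [rcMeasureW_real_eq_sum_div w hq B {a}, Finset.sum_eq_single a]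
  · rw [DecisionTree.ind_of_mem (Set.mem_singleton a), mul_one]
  · intro b _ hb
    rw [DecisionTree.ind_of_not_mem (fun h => hb (Set.mem_singleton_iff.1 h)), mul_zero]
  · intro h; exact (h (Finset.mem_univ a)).elim

/-- `φ^B_{w,q}`, `q ≥ 1`, satisfies the FKG lattice condition on point masses. [cite: Grimmett2006, Thm. (3.8)(a)] -/
theorem rcMeasureW_real_singleton_lattice {V : Type*} [Fintype V] (w : Sym2 V → unitInterval) {q : ℝ} (hq : 1 ≤ q)
    (B : Set V) (a b : BondConfig V) :
    (rcMeasureW w q B).real {a} * (rcMeasureW w q B).real {b} ≤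
      (rcMeasureW w q B).real {a ∩ b} * (rcMeasureW w q B).real {a ∪ b} := by
  have hq0 : 0 < q := one_pos.trans_le hq
  have hZ := rcPartitionFunctionW_pos w hq0 B
  simp only [rcMeasureW_real_singleton w hq0 B, div_mul_div_comm]
  exact div_le_div_of_nonneg_right (rcWeightW_lattice_condition w hq B a b) (mul_pos hZ hZ).le

/-- The FKG-lattice form implies the FK form for every `q ≥ 1`. [cite: Grimmett2006, Thm. (3.8)(a)] -/
theorem additiveGluingFK_of_fkgLattice (h : AdditiveGluingFKGLattice) {q : ℝ} (hq : 1 ≤ q) : AdditiveGluingFK q := by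
  rw [additiveGluingFK_iff_under]
  intro n w A o b
  exact h n (rcMeasureW w q ∅) (isProbabilityMeasure_rcMeasureW w (one_pos.trans_le hq) ∅)
    (rcMeasureW_real_singleton_lattice w hq ∅) A o b

/-! ### `q = 1`: the analogues are the Bernoulli statements -/

/-- At `q = 1`, FK additive gluing is the route crux `AdditiveGluing`. [cite: Grimmett2006, §1.2, pp. 4–6 (q = 1)] -/
theorem additiveGluingFK_one_iff : AdditiveGluingFK 1 ↔ PercNearOneGluing.AdditiveGluing := by
  unfold AdditiveGluingFK PercNearOneGluing.AdditiveGluing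
  simp only [rcMeasureW_one]

/-- At `q = 1`, FK near-one gluing is the route crux `NearOneGluing` (Kozma–Nitzan Conjecture 3).
[cite: Grimmett2006, §1.2, pp. 4–6 (q = 1)] -/
theorem nearOneGluingFK_one_iff : NearOneGluingFK 1 ↔ PercNearOneGluingNoHeavy.NearOneGluing := by
  unfold NearOneGluingFK PercNearOneGluingNoHeavy.NearOneGluing
  simp only [rcMeasureW_one]

/-- At `q = 1`, FK no-heavy-lower-tail is the route crux `NoHeavyLowerTail`. [cite: Grimmett2006, §1.2, pp. 4–6 (q = 1)] -/
theorem noHeavyLowerTailFK_one_iff : NoHeavyLowerTailFK 1 ↔ PercNearOneGluingNoHeavy.NoHeavyLowerTail := by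
  unfold NoHeavyLowerTailFK PercNearOneGluingNoHeavy.NoHeavyLowerTail
  simp only [rcMeasureW_one]

/-- At `q = 1`, FK one-cluster conditional positive association holds: it is van den Berg–Häggström–Kahn's Theorem 1.3,
proved in the tree (`BHK2006_clusterConditionalPositiveAssociation_holds`). [cite: VandenbergHaggstromKahn2005, Thm. 1.3 (p. 6)] -/
theorem clusterCPAFK_one : ClusterCPAFK 1 := by
  intro n w s X F G hF hG hs
  simpa only [rcMeasureW_one] using BHK2006_clusterConditionalPositiveAssociation_holds (Fin n) w s X F G hF hG hs

/-- **FK additive gluing implies FK near-one gluing**, for every `q`, with `δ = ε/2` — the measure-agnostic argument of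
`additiveGluingSuffices_proof`. [cite: KozmaNitzan2024, Conj. 1 ⇒ Conj. 3 (p. 15)] -/
theorem nearOneGluingFK_of_additiveGluingFK (q : ℝ) (hAG : AdditiveGluingFK q) : NearOneGluingFK q := by
  intro ε hε
  refine ⟨ε / 2, by positivity, ?_⟩
  intro n w A o b hoA hAb
  have key := hAG n w A o b (ε / 2) (by positivity) (fun a ha => (hAb a ha).le)
  linarith

/-! ### The conditioned slack hierarchy with the measure as a parameter -/

variable {V : Type*}

/-- The decoy constant `c(u) = μ(d ↮ A, d ↔ u) / μ(d ↮ A)` for a general measure `μ` (`CSH.avoidConst` with `μ` for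
`prodBernoulli w`). (transcription of the cell memo prim-hp-8 PROOF-S5-ALL-R.md §1.1, measure-parametrised) -/
def avoidConstμ (μ : Measure (BondConfig V)) (d : V) (A : Set V) : V → ℝ := fun u =>
  μ.real ({ω : BondConfig V | ∀ a ∈ A, ¬ (openGraph ω).Reachable d a} ∩ openConn d u) /
    μ.real {ω : BondConfig V | ∀ a ∈ A, ¬ (openGraph ω).Reachable d a}

/-- The decoy/constant list for a general measure `μ` (`CSH.decoyList` with `μ` for `prodBernoulli w`).
(transcription of the cell memo prim-hp-8 PROOF-S5-ALL-R.md §1.1, measure-parametrised) -/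
def decoyListμ (μ : Measure (BondConfig V)) : Set V → List V → List (V × (V → ℝ))
  | _, [] => []
  | A, d :: ds => (d, avoidConstμ μ d A) :: decoyListμ μ (insert d A) ds

/-- The observers' constant `p = μ(o ↔ v, v ↮ A) / μ(v ↮ A)` for a general measure `μ` (`CSH.obsConst` with `μ` for
`prodBernoulli w`). (transcription of the cell memo prim-hp-8 PROOF-S5-ALL-R.md §1.1, measure-parametrised) -/
def obsConstμ (μ : Measure (BondConfig V)) (o v : V) (A : Set V) : ℝ :=
  μ.real ({ω : BondConfig V | ∀ a ∈ A, ¬ (openGraph ω).Reachable v a} ∩ openConn o v) /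
    μ.real {ω : BondConfig V | ∀ a ∈ A, ¬ (openGraph ω).Reachable v a}

/-- The denominator-free conditional covariance `covD(f, u)` for a general measure `μ` (`CSH.covD` with `μ` for
`prodBernoulli w`). (transcription of the cell memo prim-hp-8 PROOF-S5-ALL-R.md §1.1, measure-parametrised) -/
def covDμ (μ : Measure (BondConfig V)) (x : V) (Y : Set V) (f : Set (Sym2 V) → ℝ) (u : V) : ℝ :=
  μ.real {ω : BondConfig V | ∀ y ∈ Y, ¬ (openGraph ω).Reachable x y} *
      (∫ ω in {ω : BondConfig V | ∀ y ∈ Y, ¬ (openGraph ω).Reachable x y} ∩ openConn x u,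
        f (openEdgeCluster ω x) ∂μ) -
    (∫ ω in {ω : BondConfig V | ∀ y ∈ Y, ¬ (openGraph ω).Reachable x y}, f (openEdgeCluster ω x) ∂μ) *
      μ.real ({ω : BondConfig V | ∀ y ∈ Y, ¬ (openGraph ω).Reachable x y} ∩ openConn x u)

/-- The CSH margin for a general measure `μ` (`CSH.cshMargin` with `μ` for `prodBernoulli w`; the level forms
`CSH.cshMarg` are the tree's). (transcription of the cell memo prim-hp-8 PROOF-S5-ALL-R.md §1.1, measure-parametrised) -/
def cshMarginμ (μ : Measure (BondConfig V)) (x : V) (Y : Set V) (D : List V) (o v : V)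
    (f : Set (Sym2 V) → ℝ) : ℝ :=
  CSH.cshMarg (decoyListμ μ (insert x Y) D) (obsConstμ μ o v (insert x Y ∪ {d | d ∈ D})) o v (covDμ μ x Y f)

/-- **CSH(Y; x; D; o, v) for a general measure `μ`**: the margin is nonnegative for every monotone functional of the
open edge cluster of the owner (`CSH.CSHHolds` with `μ` for `prodBernoulli w`).
(transcription of the cell memo prim-hp-8 PROOF-S5-ALL-R.md §1.1, measure-parametrised) -/
def CSHHoldsFor (μ : Measure (BondConfig V)) (x : V) (Y : Set V) (D : List V) (o v : V) : Prop :=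
  ∀ f : Set (Sym2 V) → ℝ, Monotone f → 0 ≤ cshMarginμ μ x Y D o v f

/-- With `μ = prodBernoulli w` the decoy constants are the tree's. [folklore] -/
theorem avoidConstμ_prodBernoulli (w : Sym2 V → unitInterval) (d : V) (A : Set V) :
    avoidConstμ (prodBernoulli w) d A = CSH.avoidConst w d A := rfl

/-- With `μ = prodBernoulli w` the decoy list is the tree's. [folklore] -/
theorem decoyListμ_prodBernoulli (w : Sym2 V → unitInterval) (A : Set V) (D : List V) :
    decoyListμ (prodBernoulli w) A D = CSH.decoyList w A D := by
  induction D generalizing A with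
  | nil => rfl
  | cons d ds ih => simp only [decoyListμ, CSH.decoyList, ih, avoidConstμ_prodBernoulli]

/-- With `μ = prodBernoulli w` the margin is the tree's `CSH.cshMargin`. [folklore] -/
theorem cshMarginμ_prodBernoulli (w : Sym2 V → unitInterval) (x : V) (Y : Set V) (D : List V) (o v : V)
    (f : Set (Sym2 V) → ℝ) : cshMarginμ (prodBernoulli w) x Y D o v f = CSH.cshMargin w x Y D o v f := by
  unfold cshMarginμ CSH.cshMargin
  rw [decoyListμ_prodBernoulli]
  rfl

/-- With `μ = prodBernoulli w`, `CSHHoldsFor` is the tree's `CSH.CSHHolds`. [folklore] -/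
@[simp] theorem cshHoldsFor_prodBernoulli_iff (w : Sym2 V → unitInterval) (x : V) (Y : Set V) (D : List V)
    (o v : V) : CSHHoldsFor (prodBernoulli w) x Y D o v ↔ CSH.CSHHolds w x Y D o v := by
  unfold CSHHoldsFor CSH.CSHHolds
  simp only [cshMarginμ_prodBernoulli]

/-- **FK(`q`) conditioned slack hierarchy** — memo Theorem 1 in the hypothesis shape of `CSH.cshAll` (non-degenerate
weights, distinct named vertices, vertex types `Fin n`) with `φ_{w,q} = rcMeasureW w q ∅` in place of `prodBernoulli w`.
Parametrised by `q`; `q = 1` is `CSH.cshAll` via `cshFK_one_iff` (builds on p205010 (kernel theorem, internal audit signed;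
external expert review pending)). (transcription of the cell memo prim-hp-8 PROOF-S5-ALL-R.md Thm 1, FK-parametrised)
[cite: VandenbergHaggstromKahn2005, §2.1 (pp. 9–13)] [cite: Grimmett2006, §1.4 eq. (1.20) (p. 15)] -/
def CSHFK (q : ℝ) : Prop :=
  ∀ (n : ℕ) (w : Sym2 (Fin n) → unitInterval), (∀ e, 0 < w e ∧ w e < 1) →
    ∀ (o v x : Fin n) (Y : Finset (Fin n)) (D : List (Fin n)),
    o ≠ v → x ∉ Y → o ≠ x → v ≠ x → o ∉ Y → v ∉ Y → D.Nodup → (∀ d ∈ D, d ≠ x ∧ d ∉ Y ∧ d ≠ o ∧ d ≠ v) →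
    CSHHoldsFor (rcMeasureW w q ∅) x (↑Y : Set (Fin n)) D o v

/-- At `q = 1`, `CSHFK 1` is literally the statement of memo Theorem 1 `CSH.cshAll`. [cite: Grimmett2006, §1.2, pp. 4–6 (q = 1)] -/
theorem cshFK_one_iff : CSHFK 1 ↔
    ∀ (n : ℕ) (w : Sym2 (Fin n) → unitInterval), (∀ e, 0 < w e ∧ w e < 1) →
      ∀ (o v x : Fin n) (Y : Finset (Fin n)) (D : List (Fin n)),
      o ≠ v → x ∉ Y → o ≠ x → v ≠ x → o ∉ Y → v ∉ Y → D.Nodup → (∀ d ∈ D, d ≠ x ∧ d ∉ Y ∧ d ≠ o ∧ d ≠ v) →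
      CSH.CSHHolds w x (↑Y : Set (Fin n)) D o v := by
  unfold CSHFK
  simp only [rcMeasureW_one, cshHoldsFor_prodBernoulli_iff]

/-! ### Nodes recording the exact-census findings of 2026-08-20 (appended; statements only, NOT asserted) -/

/-- **Additive gluing for every random-cluster measure with POSITIVE cluster weight `q > 0`** (all finite weighted graphs, free
boundary condition).  CONJECTURE-SHAPED STATEMENT, NOT asserted.  Recorded because the lane's exact censuses (fk-2 engine A, fk-3,
ttrl cp-hp5 `FK-CHAIN.md`, 2026-08-20: `AdditiveGluingFK q` with `0` exact violations for `q ∈ {10⁻⁵, 10⁻³, 1/10, 1/2, 5/4, 3/2, 2, 5/2,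
3, 4, 10, 100}`, `n ≤ 6` exhaustive on the tested weight palettes) show no `q`-sensitivity at all, although `φ_{w,q}` is NOT positively
associated for `q < 1` — so positive association is not the mechanism, and indeed the FKG-lattice form `AdditiveGluingFKGLattice` is
refuted (`FK.not_additiveGluingFKGLattice`, file `PercNearOneGluingNoHeavyLowerTailFKGLatticeRefutation.lean`).  Contains
`AdditiveGluingFKMonotone` (`q ≥ 1`) and the tree theorem at `q = 1` (builds on p205010 (kernel theorem, internal audit signed; external
expert review pending)). [cite: KozmaNitzan2024, Conj. 1 (p. 3)] [cite: Grimmett2006, §1.4 eq. (1.20) (p. 15)] -/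
@[conjecture] def AdditiveGluingFKPos : Prop := ∀ q : ℝ, 0 < q → AdditiveGluingFK q

/-- **The conditioned slack hierarchy for every random-cluster measure with `q ≥ 1`** (memo Theorem 1's statement `CSHFK q` for all
`q ≥ 1`).  CONJECTURE-SHAPED STATEMENT, NOT asserted: `q = 1` is `CSH.cshAll` (builds on p205010 (kernel theorem, internal audit signed;
external expert review pending)); census-clean at the edge level for `q ∈ {2, 3, 4, 10, 100}`, `n ≤ 5` (ttrl cp-cshx / fk-3, 2026-08-20);
for `q < 1` the statement is FALSE at the edge level (fk-3: `q = 1/10` violates CSH in 180/480 placements on `K₅`), so — unlike additive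
gluing (`AdditiveGluingFKPos`) — the hierarchy itself is `q`-sensitive below `1`. [cite: VandenbergHaggstromKahn2005, §2.1 (pp. 9–13)]
[cite: Grimmett2006, §1.4 eq. (1.20) (p. 15); Thm. (3.8)] -/
@[conjecture] def CSHFKMonotone : Prop := ∀ q : ℝ, 1 ≤ q → CSHFK q

end FK

end Summit.CriticalPhenomena.PercolationContinuityZ3.Theorems

end
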